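import Summits.BirchSwinnertonDyer.BirchSwinnertonDyer.Theorems.ManinLocalTwoThreeCDivisionIntegralCDT
import HarnessLib

/-!
# C3 `ManinPrimeToThreeAtNine` — the CONDITIONAL closer of record (modulo the one printed fact CDT)
(route `ManinLocalTwoThree`, crux C3 stmt-BirchSwinnertonDyer-22968; cell bsd-f2-manin, prover seat p2 gen 22)

`maninLocalTwoThree_maninPrimeToThreeAtNine_of_CDT` concludes the route decl
`Summit.BirchSwinnertonDyer.BirchSwinnertonDyer.Theses.ManinLocalTwoThree.ManinPrimeToThreeAtNine` BY NAME under exactly one named, statement-only,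
PRINTED Literature fact taken as a hypothesis:

* `hCDT : Literature.NumberTheory.Automorphic.CalegariDimitrovTang2025_unboundedDenominators` — Calegari–Dimitrov–Tang, J. Amer. Math. Soc. 38
  (2025) Thm 1 (unbounded denominators), holomorphic-at-the-cusps special case.

It is p2 gen 21's `CDivisionInt.maninPrimeToThreeAtNine_of_CDTInt` (p756488): the integer `c`-division witness (Honda integrality of the
`X₀(N)`-parametrisation divided by `c₀`) is modular for the finite-index stabiliser of the `c₀`-division periods; CDT makes that group a congruence
subgroup, the `Γ₁`-Wohlfahrt kernel gives `Γ₁(N)` inside it, so `Λ₁(f) ⊆ Λ_W = c₀Λ₀(f)` (an/LEAD/p2 `CDivision*`); at a traceless prime `3`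
(`9 ∣ N ⟹ a₃ = 0`, Atkin–Lehner) Ling–Oesterlé gives `3Λ₀(f) ⊆ Λ₁(f)`, whence `c₀ ∣ 3`, and `|c₀| = 3` is the index-`9` configuration, excluded
unconditionally.

HONEST FRAMING.  This is a CONDITIONAL result (the gate records `conditional-result`); the item's own signature is NOT proved, because CDT is an
undischarged `def … : Prop` hypothesis (a Literature programme).  The route binders Mazur / Abbes–Ullmo / Česnavičius / modularity are unused by
this proof.  BSD is not proved; Manin's conjecture is not proved; C3 stays OPEN as filed.
[cite: CalegariDimitrovTang2025, Thm. 1] [cite: LingOesterle1991, Thm. 6] [cite: AtkinLehner1970, Thm. 3]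
-/

set_option autoImplicit false

namespace Summit.BirchSwinnertonDyer.BirchSwinnertonDyer.Theorems

/-- **C3 `ManinPrimeToThreeAtNine` modulo {CDT}** (CONDITIONAL closer; the hypothesis is a printed, statement-only Literature fact; nothing else
is assumed).  [cite: CalegariDimitrovTang2025, Thm. 1] [cite: LingOesterle1991, Thm. 6] -/
theorem maninLocalTwoThree_maninPrimeToThreeAtNine_of_CDT
    (hCDT : Literature.NumberTheory.Automorphic.CalegariDimitrovTang2025_unboundedDenominators) :
    Summit.BirchSwinnertonDyer.BirchSwinnertonDyer.Theses.ManinLocalTwoThree.ManinPrimeToThreeAtNine :=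
  ManinLocalTwoThree.CDivisionInt.maninPrimeToThreeAtNine_of_CDTInt hCDT

end Summit.BirchSwinnertonDyer.BirchSwinnertonDyer.Theorems
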